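import Summits.QuantumFields.YangMills.Theses.ParabolicTrajectory
import Summits.QuantumFields.YangMills.Theorems.ParabolicTrajectoryParabolicCentreCurveGraph

/-!
# Route `ParabolicTrajectory` — item `ParabolicCentreCurve` (stmt-QuantumFields-9175): closing file

`parabolicCentreCurve_proof : ParabolicCentreCurve` — the abstract Banach-space centre-unstable
curve theorem of the route, proved unconditionally.

Given the hypothesis block (`b > 0`, `0 ≤ θ < 1`, `C, δ > 0`, `‖A‖ ≤ θ`, remainder / fibre-Lipschitz /
base-Lipschitz bounds on the chart `|g|, ‖y‖ ≤ δ`), choose `η = 1 − θ`, `C' = 2C/η`, `L = η/2`,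
`S = 1 + η/4`, `κ = 1 − η/2` and a radius `δ₁ ≤ δ` with `2Cδ₁ ≤ b`, `2bδ₁² ≤ 1`, `2Cδ₁ ≤ η`,
`15Cδ₁ ≤ η²`, `15bδ₁² + 15Cδ₁³ ≤ η` (`exists_delta1`). The coupled graph transform
(`exists_backward_graph`) gives an `L`-Lipschitz graph `h` on `[0, δ₁]` in the wedge `‖h g‖ ≤ C' g²`,
forward invariant wherever the base point stays in `[0, δ₁]` (`forward_invariance`). The witnesses
of the route decl are `δ' = δ₁/2`, `K = 1`, `θ₁ = θ + 3Cδ₁ + Cδ₁³ < 1`, `C'`, `h`: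

* invariance on `[0, δ']` is forward invariance (the image base point is `≤ 2g ≤ δ₁`);
* **uniqueness** among continuous invariant graphs `h'` through `0` staying in the chart: every
  `g₀ ∈ [0, δ']` has a preimage `g₁ ≤ g₀` under the continuous base map `t ↦ φ t (h' t)` (IVT,
  `continuousOn_base`), and one step contracts the discrepancy, `‖h' g₀ − h g₀‖ ≤ θ₁ ‖h' g₁ − h g₁‖`
  (`step_contract`); iterating, `‖h' − h‖ ≤ θ₁ⁿ δ₁ → 0`;
* **attraction**: the same one-step estimate along any orbit segment staying in the chart.
-/

open Set Filter Topology

namespace Summit.QuantumFields.YangMills.Theorems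

open Summit.QuantumFields.YangMills.Theses.ParabolicTrajectory
open Summit.QuantumFields.YangMills.Theorems.ParabolicCentreCurve

/-- **The parabolic centre-unstable curve** (item `stmt-QuantumFields-9175`, route
`ParabolicTrajectory`): existence, `C' g²`-flatness, invariance, uniqueness among continuous
invariant graphs through `0` staying in the chart, and exponential attraction of in-chart orbit
segments, for the abstract step `F(g, y) = (g + b g³ + ρ₁, A y + ρ₂)` on `ℝ × E`.
Lipschitz graph transform (Hirsch–Pugh–Shub 1977 §5; Baldomá–Fontich–de la Llave–Martín 2007),
here in the coupled `(σ, h)` form of `exists_backward_graph`. [folklore] -/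
theorem parabolicCentreCurve_proof : ParabolicCentreCurve := by
  intro E _ _ _ φ Ψ A b θ C δ hb hθ hθ1 hC hδ hA H1 H2 H3
  have hη0 : 0 < 1 - θ := by linarith
  obtain ⟨δ₁, hδ₁, hδ₁δ, hK2, hK3, hK1, hK7, hK8⟩ := exists_delta1 (C := C) (η := 1 - θ) hb hη0 hδ
  have hbδ : 0 ≤ b * δ₁ ^ 2 := by positivity
  have hCδ : 0 ≤ C * δ₁ := by positivity
  have hCδ3 : 0 ≤ C * δ₁ ^ 3 := by positivity
  have hη2 : (1 - θ) ^ 2 ≤ 1 - θ := by nlinarith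
  -- constants
  have hC' : (1 - θ) * (2 * C / (1 - θ)) = 2 * C := by field_simp
  have hC'0 : 0 ≤ 2 * C / (1 - θ) := by positivity
  have hC'δ₁ : 2 * C / (1 - θ) * δ₁ ≤ 1 := by
    rw [div_mul_eq_mul_div, div_le_one hη0]; linarith
  have hL0 : 0 < (1 - θ) / 2 := by positivity
  have hL1 : (1 - θ) / 2 ≤ 1 := by linarith
  have hS1 : (1 : ℝ) ≤ 1 + (1 - θ) / 4 := by linarith
  have hκ0 : 0 ≤ 1 - (1 - θ) / 2 := by linarith
  have hκ1 : 1 - (1 - θ) / 2 < 1 := by linarith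
  obtain ⟨hR2, hR3, hR4, hR5⟩ := consts_ineq (u := C * δ₁) (w := b * δ₁ ^ 2) (z := C * δ₁ ^ 3)
    hη0 (by linarith) hCδ hbδ (by linarith) (by linarith)
  have hR2' : 1 + (3 * b * δ₁ ^ 2 + 3 * C * δ₁ ^ 3) * (1 + (1 - θ) / 4) ≤ 1 + (1 - θ) / 4 := by
    linarith
  have hR3' : (3 * C * δ₁ + (θ + 3 * C * δ₁) * ((1 - θ) / 2)) * (1 + (1 - θ) / 4) ≤
      (1 - θ) / 2 := by linarith
  have hR4' : 3 * b * δ₁ ^ 2 + 4 * C * δ₁ ^ 3 ≤ 1 - (1 - θ) / 2 := by linarith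
  have hR5' : 3 * C * δ₁ + (θ + 3 * C * δ₁) * ((1 - θ) / 2 + 1) ≤ 1 - (1 - θ) / 2 := by linarith
  have hK9 : 3 * C * δ₁ ^ 3 < 1 := by linarith
  have hθ₁0 : 0 ≤ θ + 3 * C * δ₁ + C * δ₁ ^ 3 := by positivity
  have hθ₁1 : θ + 3 * C * δ₁ + C * δ₁ ^ 3 < 1 := by nlinarith
  -- the graph
  obtain ⟨σ, h, hσ, hbd, hlip, hback1, hback2⟩ := exists_backward_graph (H1 := H1) (H2 := H2)
    (H3 := H3) hθ hb hC hA hδ₁ hδ₁δ hK2 hK3 hC' hC'0 hC'δ₁ hL0 hL1 hS1 hκ0 hκ1 hR2' hR3' hR4' hR5'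
  have hinv : ∀ g ∈ Icc (0 : ℝ) δ₁, φ g (h g) ≤ δ₁ → Ψ g (h g) = h (φ g (h g)) :=
    fun g hg hug => forward_invariance (H1 := H1) (H2 := H2) (H3 := H3) hb hC hδ₁δ hK2 hK9 hC'0
      hC'δ₁ hL1 hσ hbd hlip hback1 hback2 hg hug
  have hwedge : ∀ s ∈ Icc (0 : ℝ) δ₁, ‖h s‖ ≤ s := by
    intro s hs
    calc ‖h s‖ ≤ 2 * C / (1 - θ) * s ^ 2 := hbd s hs
      _ = 2 * C / (1 - θ) * s * s := by ring
      _ ≤ 1 * s :=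
          mul_le_mul_of_nonneg_right ((mul_le_mul_of_nonneg_left hs.2 hC'0).trans hC'δ₁) hs.1
      _ = s := one_mul s
  have hu : ∀ g ∈ Icc (0 : ℝ) δ₁, ∀ y : E, ‖y‖ ≤ δ₁ → g ≤ φ g y ∧ φ g y ≤ g + 2 * b * g ^ 3 := by
    intro g hg y hy
    have := base_step_bounds (H1 := H1) hC hδ₁δ hK2 hg.1 hg.2 hy
    constructor <;> linarith [this.1, this.2]
  have hu2 : ∀ g ∈ Icc (0 : ℝ) (δ₁ / 2), ∀ y : E, ‖y‖ ≤ δ₁ → φ g y ≤ δ₁ := by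
    intro g hg y hy
    have hgδ₁ : g ≤ δ₁ := hg.2.trans (by linarith)
    have h2 := (hu g ⟨hg.1, hgδ₁⟩ y hy).2
    have hg3 : g ^ 3 ≤ δ₁ ^ 2 * g := by
      have e : g ^ 3 = g ^ 2 * g := by ring
      rw [e]; exact mul_le_mul_of_nonneg_right (pow_le_pow_left₀ hg.1 hgδ₁ 2) hg.1
    have h3 : 2 * b * g ^ 3 ≤ 2 * b * (δ₁ ^ 2 * g) := mul_le_mul_of_nonneg_left hg3 (by positivity)
    have h4 : 2 * b * δ₁ ^ 2 * g ≤ 1 * g := mul_le_mul_of_nonneg_right hK3 hg.1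
    linarith [hg.2]
  have hstep : ∀ g ∈ Icc (0 : ℝ) (δ₁ / 2), ∀ y : E, ‖y‖ ≤ δ₁ →
      ‖Ψ g y - h (φ g y)‖ ≤ (θ + 3 * C * δ₁ + C * δ₁ ^ 3) * ‖y - h g‖ := by
    intro g hg y hy
    have hg' : g ∈ Icc (0 : ℝ) δ₁ := ⟨hg.1, hg.2.trans (by linarith)⟩
    have hug : φ g (h g) ≤ δ₁ := hu2 g hg (h g) ((hwedge g hg').trans hg'.2)
    exact step_contract (H2 := H2) hC hA hδ₁δ hC'0 hC'δ₁ hL1 hlip hbd hg' hy (hinv g hg' hug)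
  have φ00 : φ 0 0 = 0 := by
    have h0 := (H1 0 0 (by rw [abs_zero]; exact hδ.le) (by rw [norm_zero]; exact hδ.le)).1
    have h0' : |φ 0 0| ≤ 0 := by simpa using h0
    exact abs_nonpos_iff.1 h0'
  refine ⟨δ₁ / 2, 1, θ + 3 * C * δ₁ + C * δ₁ ^ 3, 2 * C / (1 - θ), h, by positivity, by linarith,
    hθ₁0, hθ₁1, ?_, ?_, ?_, ?_, ?_, ?_⟩
  · -- continuity
    exact (LipschitzWith.of_dist_le_mul (K := ((1 - θ) / 2).toNNReal) fun t t' => by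
      rw [dist_eq_norm, Real.dist_eq, Real.coe_toNNReal _ hL0.le]
      exact hlip t t').continuous.continuousOn
  · -- h 0 = 0
    have h0 := hbd 0 ⟨le_rfl, hδ₁.le⟩
    have h0' : ‖h 0‖ ≤ 0 := by simpa using h0
    exact norm_le_zero_iff.1 h0'
  · -- wedge
    intro g hg
    exact hbd g ⟨hg.1, hg.2.trans (by linarith)⟩
  · -- invariance
    intro g hg hφ
    exact hinv g ⟨hg.1, hg.2.trans (by linarith)⟩ (hφ.trans (by linarith))
  · -- uniqueness
    intro h' hc h0' hbd' hinv' g hg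
    have hcontu := continuousOn_base (H2 := H2) (H3 := H3) hb hC (δ' := δ₁ / 2) (by linarith)
      hc hbd'
    have claim : ∀ n : ℕ, ∀ g ∈ Icc (0 : ℝ) (δ₁ / 2),
        ‖h' g - h g‖ ≤ (θ + 3 * C * δ₁ + C * δ₁ ^ 3) ^ n * δ₁ := by
      intro n
      induction n with
      | zero =>
        intro g hg
        rw [pow_zero, one_mul]
        have hg' : g ∈ Icc (0 : ℝ) δ₁ := ⟨hg.1, hg.2.trans (by linarith)⟩
        calc ‖h' g - h g‖ ≤ ‖h' g‖ + ‖h g‖ := norm_sub_le _ _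
          _ ≤ δ₁ / 2 + δ₁ / 2 := add_le_add (hbd' g hg) ((hwedge g hg').trans hg.2)
          _ = δ₁ := by ring
      | succ n ih =>
        intro g₀ hg₀
        have hivt := intermediate_value_Icc hg₀.1 (hcontu.mono (Icc_subset_Icc_right hg₀.2))
        have hlow := (hu g₀ ⟨hg₀.1, hg₀.2.trans (by linarith)⟩ (h' g₀)
          ((hbd' g₀ hg₀).trans (by linarith))).1
        have hmem : g₀ ∈ Icc (φ 0 (h' 0)) (φ g₀ (h' g₀)) := ⟨by rw [h0', φ00]; exact hg₀.1, hlow⟩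
        obtain ⟨g₁, hg₁, hg₁eq⟩ := hivt hmem
        have hg₁eq : φ g₁ (h' g₁) = g₀ := hg₁eq
        have hg₁' : g₁ ∈ Icc (0 : ℝ) (δ₁ / 2) := ⟨hg₁.1, hg₁.2.trans hg₀.2⟩
        have hinvg₁ := hinv' g₁ hg₁' (by rw [hg₁eq]; exact hg₀.2)
        rw [hg₁eq] at hinvg₁
        have hst := hstep g₁ hg₁' (h' g₁) ((hbd' g₁ hg₁').trans (by linarith))
        rw [hg₁eq, hinvg₁] at hst
        calc ‖h' g₀ - h g₀‖ ≤ (θ + 3 * C * δ₁ + C * δ₁ ^ 3) * ‖h' g₁ - h g₁‖ := hst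
          _ ≤ (θ + 3 * C * δ₁ + C * δ₁ ^ 3) * ((θ + 3 * C * δ₁ + C * δ₁ ^ 3) ^ n * δ₁) :=
              mul_le_mul_of_nonneg_left (ih g₁ hg₁') hθ₁0
          _ = (θ + 3 * C * δ₁ + C * δ₁ ^ 3) ^ (n + 1) * δ₁ := by ring
    have hlim : Tendsto (fun n : ℕ => (θ + 3 * C * δ₁ + C * δ₁ ^ 3) ^ n * δ₁) atTop (𝓝 0) := by
      simpa using (tendsto_pow_atTop_nhds_zero_of_lt_one hθ₁0 hθ₁1).mul_const δ₁
    have h0le : ‖h' g - h g‖ ≤ 0 := ge_of_tendsto' hlim fun n => claim n g hg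
    exact sub_eq_zero.1 (norm_le_zero_iff.1 h0le)
  · -- attraction
    intro p k hk
    rw [one_mul]
    set F : ℝ × E → ℝ × E := fun q => (φ q.1 q.2, Ψ q.1 q.2) with hF
    suffices H : ∀ j ≤ k, ‖(F^[j] p).2 - h (F^[j] p).1‖ ≤
        (θ + 3 * C * δ₁ + C * δ₁ ^ 3) ^ j * ‖p.2 - h p.1‖ from H k le_rfl
    intro j
    induction j with
    | zero => intro _; simp
    | succ j ih =>
      intro hjk
      have hj := hk j (by omega)
      rw [Function.iterate_succ_apply']
      have e1 : (F (F^[j] p)).1 = φ (F^[j] p).1 (F^[j] p).2 := by rw [hF]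
      have e2 : (F (F^[j] p)).2 = Ψ (F^[j] p).1 (F^[j] p).2 := by rw [hF]
      rw [e1, e2]
      calc ‖Ψ (F^[j] p).1 (F^[j] p).2 - h (φ (F^[j] p).1 (F^[j] p).2)‖
            ≤ (θ + 3 * C * δ₁ + C * δ₁ ^ 3) * ‖(F^[j] p).2 - h (F^[j] p).1‖ :=
              hstep _ hj.1 _ (hj.2.trans (by linarith))
        _ ≤ (θ + 3 * C * δ₁ + C * δ₁ ^ 3) *
              ((θ + 3 * C * δ₁ + C * δ₁ ^ 3) ^ j * ‖p.2 - h p.1‖) :=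
              mul_le_mul_of_nonneg_left (ih (by omega)) hθ₁0
        _ = (θ + 3 * C * δ₁ + C * δ₁ ^ 3) ^ (j + 1) * ‖p.2 - h p.1‖ := by ring

end Summit.QuantumFields.YangMills.Theorems
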